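import Summits.ResolutionOfSingularities.ResolutionOfSingularities.Theorems.WildConesCampaignW46HypersurfacesCharTwoNullPolar

/-!
# [OURS · L1 W4.6, rung (ii) at p = 2, EVERY dimension n] FREE POINTS: two non-proportional FREE
# infinitely-near double points force `h₂ = 1`; so in the multiple-tangent class `(e, h₂) = (2, 2)` there
# is AT MOST ONE free near point besides the (at most one) satellite — AT MOST TWO infinitely-near double
# points in all — `z² = a(u₁,…,uₙ)` over every field of characteristic 2

HONEST FRAMING. Everything here is OURS: theorems about route WildCones' own TYPED point-blow-up dynamics
(`Theorems/WildConesClassicalRegimesDefs.lean`) and the seat's invariants `polarMatrix` (p502936),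
`milnorEmbDim` (p498937), `milnorHilbertTwo` (p511581), `degForm` (p522667). NOTHING here is a statement
of the manuscript [Hironaka2017]; no FACT-LIST premise; AI review is weaker than expert review. Cell
res-hironaka (LADDER-RESOLUTION rung L, D-0089), slot W4.6, seat res-L1-s46-pv-4 (gen 6); host route
`WildCones`, crux `ClassicalRegimes` (stmt-ResolutionOfSingularities-16884; proved).

THE OBJECTS. `c` a double state of `z² = a(u₁,…,uₙ)` with corank `e(c) = 2`; `K = ker P` the kernel
plane of the polar form; `polar(λ, v) = Σₛ λₛ (∂ₛa)₂(v)`. A near vector `w ∈ K` (`a₃(w) = 0`) is FREE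
when some kernel polar is non-zero at `w` (⟺ its successor has corank `0`, p533887: isolated, `μ = 1`,
no double point after it) and a SATELLITE when all kernel polars vanish at `w` (⟺ successor corank `2`).

THE ARGUMENT. Let `w₁, w₂ ∈ K` be non-proportional near vectors, both free. By Euler in characteristic
two `polar(w, w) = a₃(w) = 0` (p528427), so in the basis `w₁, w₂` the only polar values are the MIXED
ones, `m₁ = polar(w₂, w₁)` and `m₂ = polar(w₁, w₂)`; freeness of `wᵢ` says exactly `mᵢ ≠ 0`. A null
polar `λ = αw₁ + βw₂` has `polar(λ, w₁) = βm₁ = 0` and `polar(λ, w₂) = αm₂ = 0`, so `λ = 0`: the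
null-polar space is `N = 0`, i.e. `h₂ = 1` (p542945). In the binary normal form: two distinct simple
roots of a binary cubic make it square-free.

WHAT IS PROVED (every `n`, every field of characteristic `2`, corank `e(c) = 2`):

* `hypersurface_two_free_points_milnorHilbertTwo_eq_one` — two non-proportional free near vectors ⇒
  `h₂ = 1`; `hypersurface_free_point_unique` — at `h₂ ≥ 2` the free near vectors are pairwise
  proportional: AT MOST ONE FREE near point; `hypersurface_free_successors_proportional` — the same for
  the near vectors `(τ with τ_i = 1)` of two double successors of corank `0`;
* `hypersurface_satellite_successors_proportional` — (`h₂ ≤ 2`) two double successors of corank `2` have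
  proportional near vectors (p536239, restated dynamically);
* `hypersurface_successor_dichotomy_of_milnorHilbertTwo_le_two` — (isolated, `h₂ ≤ 2`) every double
  successor is EITHER a satellite successor (corank `2`, isolated, `μ` drops) OR a free one (corank `0`,
  isolated, `μ = 1`, no double point after it);
* `hypersurface_nearPoints_le_two_of_milnorHilbertTwo_eq_two` — **isolated, `(e, h₂) = (2, 2)` ⇒ AT MOST
  TWO infinitely-near double points** (a set `S` of `≤ 2` vectors: at most one satellite direction and at
  most one free direction). With p538084 (perfect field: the satellite exists) the multiple-tangent class
  has EXACTLY ONE satellite and at most one free near point — the census line `h₂ = 2`.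

References: [CasasAlvero2000] §3 (free and satellite points of plane curves: context only);
[GreuelPfister2026] (context); [Hironaka2017] Th. 16.6 p.84 — role replaced only, under adjudication;
nothing of it is used.
-/

noncomputable section

-- single-problem summit: the doubled namespace component `ResolutionOfSingularities` is forced
set_option linter.dupNamespace false

open scoped BigOperators Classical

open MvPowerSeries IsLocalRing

open Literature.AlgebraicGeometry.Resolution

namespace Summit.ResolutionOfSingularities.ResolutionOfSingularities.Theorems

namespace CampaignW46.HypersurfacesCharTwo

open WildCones WildCones.MuDropCharTwoOrdP ThreefoldsCharTwo

variable {κ : Type} [Field κ] {n : ℕ}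

/-! ## Two free near points force `h₂ = 1` -/

/-- [OURS · L1 W4.6 rung (ii) at `p = 2`, every dimension; NOT a statement of the manuscript] **TWO
NON-PROPORTIONAL FREE NEAR POINTS FORCE `h₂ = 1`.** Let `c` be a double state of `z² = a(u₁,…,uₙ)` (any
field of characteristic `2`) with `e(c) = 2`, and `w₁, w₂` non-proportional kernel vectors ON the
tangent cubic (`a₃(wᵢ) = 0`) which are both FREE (some kernel polar is non-zero at each). Then
`h₂(c) = 1`: the kernel cubic has two distinct simple roots, hence is square-free (three distinct
tangents, the `D₄` class). [folklore] -/
theorem hypersurface_two_free_points_milnorHilbertTwo_eq_one [CharP κ 2] (c : (Fin n → ℕ) → κ)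
    (hM : MultP 2 n κ c) (he : milnorEmbDim 2 n κ c = 2) {w₁ w₂ : Fin n → κ} (hw₁0 : w₁ ≠ 0)
    (hw₁ : Matrix.vecMul w₁ (polarMatrix (ser 2 n κ c)) = 0)
    (hw₂ : Matrix.vecMul w₂ (polarMatrix (ser 2 n κ c)) = 0) (hnot : ∀ r : κ, w₂ ≠ r • w₁)
    (hc₁ : degForm 3 (ser 2 n κ c) w₁ = 0) (hc₂ : degForm 3 (ser 2 n κ c) w₂ = 0)
    (hf₁ : ∃ v : Fin n → κ, Matrix.vecMul v (polarMatrix (ser 2 n κ c)) = 0 ∧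
      ∑ s, v s * degForm 2 (MvPowerSeries.pderiv s (ser 2 n κ c)) w₁ ≠ 0)
    (hf₂ : ∃ v : Fin n → κ, Matrix.vecMul v (polarMatrix (ser 2 n κ c)) = 0 ∧
      ∑ s, v s * degForm 2 (MvPowerSeries.pderiv s (ser 2 n κ c)) w₂ ≠ 0) :
    milnorHilbertTwo 2 n κ c = 1 := by
  set f := ser 2 n κ c with hfdef
  -- Euler: `polar(w, w) = a₃(w) = 0`
  have hd₁ : ∑ s, w₁ s * degForm 2 (MvPowerSeries.pderiv s f) w₁ = 0 := by
    rw [← degForm_three_eq_polar_self]; exact hc₁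
  have hd₂ : ∑ s, w₂ s * degForm 2 (MvPowerSeries.pderiv s f) w₂ = 0 := by
    rw [← degForm_three_eq_polar_self]; exact hc₂
  -- the mixed polars are non-zero
  have hm₁ : ∑ s, w₂ s * degForm 2 (MvPowerSeries.pderiv s f) w₁ ≠ 0 := by
    obtain ⟨v, hv, hne⟩ := hf₁
    obtain ⟨α, β, hαβ⟩ := kernel_span_pair hM he hw₁0 hw₁ hw₂ hnot v hv
    rw [← hαβ, polar_add_smul, hd₁, mul_zero, zero_add] at hne
    exact fun h0 => hne (by rw [h0, mul_zero])
  have hm₂ : ∑ s, w₁ s * degForm 2 (MvPowerSeries.pderiv s f) w₂ ≠ 0 := by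
    obtain ⟨v, hv, hne⟩ := hf₂
    obtain ⟨α, β, hαβ⟩ := kernel_span_pair hM he hw₁0 hw₁ hw₂ hnot v hv
    rw [← hαβ, polar_add_smul, hd₂, mul_zero, add_zero] at hne
    exact fun h0 => hne (by rw [h0, mul_zero])
  -- so the null-polar space is trivial
  refine (hypersurface_milnorHilbertTwo_eq_one_iff_no_null_polar c hM he).mpr fun lam hlam hnull => ?_
  obtain ⟨α, β, hαβ⟩ := kernel_span_pair hM he hw₁0 hw₁ hw₂ hnot lam hlam
  have e₁ := hnull w₁ hw₁
  have e₂ := hnull w₂ hw₂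
  rw [← hαβ, polar_add_smul, hd₁, mul_zero, zero_add] at e₁
  rw [← hαβ, polar_add_smul, hd₂, mul_zero, add_zero] at e₂
  have hβ : β = 0 := (mul_eq_zero.mp e₁).resolve_right hm₁
  have hα : α = 0 := (mul_eq_zero.mp e₂).resolve_right hm₂
  rw [← hαβ, hα, hβ, zero_smul, zero_smul, add_zero]

/-- [OURS · L1 W4.6 rung (ii) at `p = 2`, every dimension; NOT a statement of the manuscript] **AT
`h₂ ≥ 2` THERE IS AT MOST ONE FREE NEAR POINT**: for a double state with `e(c) = 2`, `h₂(c) ≥ 2`, any two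
free kernel vectors on the tangent cubic are PROPORTIONAL (one point of the kernel line `ℙ¹`).
[folklore] -/
theorem hypersurface_free_point_unique [CharP κ 2] (c : (Fin n → ℕ) → κ) (hM : MultP 2 n κ c)
    (he : milnorEmbDim 2 n κ c = 2) (hh : 2 ≤ milnorHilbertTwo 2 n κ c) {w₁ w₂ : Fin n → κ}
    (hw₁0 : w₁ ≠ 0) (hw₁ : Matrix.vecMul w₁ (polarMatrix (ser 2 n κ c)) = 0)
    (hw₂ : Matrix.vecMul w₂ (polarMatrix (ser 2 n κ c)) = 0)
    (hc₁ : degForm 3 (ser 2 n κ c) w₁ = 0) (hc₂ : degForm 3 (ser 2 n κ c) w₂ = 0)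
    (hf₁ : ∃ v : Fin n → κ, Matrix.vecMul v (polarMatrix (ser 2 n κ c)) = 0 ∧
      ∑ s, v s * degForm 2 (MvPowerSeries.pderiv s (ser 2 n κ c)) w₁ ≠ 0)
    (hf₂ : ∃ v : Fin n → κ, Matrix.vecMul v (polarMatrix (ser 2 n κ c)) = 0 ∧
      ∑ s, v s * degForm 2 (MvPowerSeries.pderiv s (ser 2 n κ c)) w₂ ≠ 0) :
    ∃ r : κ, w₂ = r • w₁ := by
  by_contra h
  push Not at h
  have h1 := hypersurface_two_free_points_milnorHilbertTwo_eq_one c hM he hw₁0 hw₁ hw₂ h hc₁ hc₂ hf₁ hf₂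
  omega

/-! ## The dynamics: successors of corank `0` and of corank `2` -/

/-- [OURS · L1 W4.6] A near vector `(τ with τ_i = 1)` is non-zero. [folklore] -/
theorem update_one_ne_zero (τ : Fin n → κ) (i : Fin n) : Function.update τ i 1 ≠ 0 := by
  intro h0
  have h := congrFun h0 i
  rw [Function.update_self, Pi.zero_apply] at h
  exact one_ne_zero h

/-- [OURS · L1 W4.6 rung (ii) at `p = 2`, every dimension; NOT a statement of the manuscript] **TWO FREE
SUCCESSORS ARE THE SAME NEAR POINT** (`h₂ ≥ 2`): for a double state with `e(c) = 2`, `h₂(c) ≥ 2`, if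
`(i, τ)` and `(i', τ')` both give double successors of corank `0`, their near vectors are proportional.
In the multiple-tangent class the free infinitely-near double point, if any, is unique. [folklore] -/
theorem hypersurface_free_successors_proportional [CharP κ 2] (c : (Fin n → ℕ) → κ) (hM : MultP 2 n κ c)
    (he : milnorEmbDim 2 n κ c = 2) (hh : 2 ≤ milnorHilbertTwo 2 n κ c) {i i' : Fin n}
    {τ τ' : Fin n → κ} (hM₁ : MultP 2 n κ (step 2 n κ i τ c)) (hM₂ : MultP 2 n κ (step 2 n κ i' τ' c))
    (he₁ : milnorEmbDim 2 n κ (step 2 n κ i τ c) = 0) (he₂ : milnorEmbDim 2 n κ (step 2 n κ i' τ' c) = 0) :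
    ∃ r : κ, Function.update τ' i' 1 = r • Function.update τ i 1 := by
  obtain ⟨hk₁, hc₁⟩ := hypersurface_ker_and_cubic_of_double_successor c i τ hM hM₁
  obtain ⟨hk₂, hc₂⟩ := hypersurface_ker_and_cubic_of_double_successor c i' τ' hM hM₂
  have hf₁ := (hypersurface_milnorEmbDim_step_eq_zero_iff c i τ hM he hM₁).mp he₁
  have hf₂ := (hypersurface_milnorEmbDim_step_eq_zero_iff c i' τ' hM he hM₂).mp he₂
  exact hypersurface_free_point_unique c hM he hh (update_one_ne_zero τ i) hk₁ hk₂ hc₁ hc₂ hf₁ hf₂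

/-- [OURS · L1 W4.6 rung (ii) at `p = 2`, every dimension; NOT a statement of the manuscript] **TWO
SATELLITE SUCCESSORS ARE THE SAME NEAR POINT** (`h₂ ≤ 2`): for a double state with `e(c) = 2`,
`h₂(c) ≤ 2`, if `(i, τ)` and `(i', τ')` both give double successors of corank `2`, their near vectors are
proportional (p536239 `hypersurface_satellite_unique` with p533887's criterion, restated for the
dynamics). [folklore] -/
theorem hypersurface_satellite_successors_proportional [CharP κ 2] (c : (Fin n → ℕ) → κ)
    (hM : MultP 2 n κ c) (he : milnorEmbDim 2 n κ c = 2) (hh : milnorHilbertTwo 2 n κ c ≤ 2) {i i' : Fin n}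
    {τ τ' : Fin n → κ} (hM₁ : MultP 2 n κ (step 2 n κ i τ c)) (hM₂ : MultP 2 n κ (step 2 n κ i' τ' c))
    (he₁ : milnorEmbDim 2 n κ (step 2 n κ i τ c) = 2) (he₂ : milnorEmbDim 2 n κ (step 2 n κ i' τ' c) = 2) :
    ∃ r : κ, Function.update τ' i' 1 = r • Function.update τ i 1 := by
  obtain ⟨hk₁, -⟩ := hypersurface_ker_and_cubic_of_double_successor c i τ hM hM₁
  obtain ⟨hk₂, -⟩ := hypersurface_ker_and_cubic_of_double_successor c i' τ' hM hM₂
  have hs₁ := (hypersurface_milnorEmbDim_step_eq_two_iff c i τ hM he hM₁).mp he₁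
  have hs₂ := (hypersurface_milnorEmbDim_step_eq_two_iff c i' τ' hM he hM₂).mp he₂
  exact hypersurface_satellite_unique c hM he hh (update_one_ne_zero τ i) hk₁ hk₂ hs₁ hs₂

/-- [OURS · L1 W4.6 rung (ii) at `p = 2`, every dimension; NOT a statement of the manuscript] **THE
SUCCESSOR DICHOTOMY AT `h₂ ≤ 2`**: for an ISOLATED double state with `e(c) = 2`, `h₂(c) ≤ 2`, every
double successor is EITHER a SATELLITE successor — corank `2`, isolated, with smaller Milnor number
(gen 4's isolatedness transfer) — OR a FREE successor — corank `0`, isolated, `μ = 1`, and no double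
point follows it (p533887). [folklore] -/
theorem hypersurface_successor_dichotomy_of_milnorHilbertTwo_le_two [CharP κ 2] (c : (Fin n → ℕ) → κ)
    (hM : MultP 2 n κ c) (hI : Isol 2 n κ c) (he : milnorEmbDim 2 n κ c = 2)
    (hh : milnorHilbertTwo 2 n κ c ≤ 2) (i : Fin n) (τ : Fin n → κ) (hM' : MultP 2 n κ (step 2 n κ i τ c)) :
    (milnorEmbDim 2 n κ (step 2 n κ i τ c) = 2 ∧ Isol 2 n κ (step 2 n κ i τ c) ∧
        mu 2 n κ (step 2 n κ i τ c) < mu 2 n κ c) ∨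
      (milnorEmbDim 2 n κ (step 2 n κ i τ c) = 0 ∧ Isol 2 n κ (step 2 n κ i τ c) ∧
        mu 2 n κ (step 2 n κ i τ c) = 1 ∧
          ∀ (i' : Fin n) (τ' : Fin n → κ), ¬ MultP 2 n κ (step 2 n κ i' τ' (step 2 n κ i τ c))) := by
  rcases hypersurface_milnorEmbDim_step_of_eq_two c i τ hM he hM' with h0 | h2
  · obtain ⟨v, hv, hne⟩ := (hypersurface_milnorEmbDim_step_eq_zero_iff c i τ hM he hM').mp h0
    exact Or.inr ⟨h0, hypersurface_simple_tangent_resolved c i τ hM he hM' hv hne⟩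
  · exact Or.inl ⟨h2, hypersurface_isol_step_of_milnorHilbertTwo_le_two c i τ hM hI he hh hM'⟩

/-! ## The census line `h₂ = 2`: at most two near double points -/

/-- [OURS · L1 W4.6 rung (ii) at `p = 2`, EVERY dimension `n`, EVERY field of characteristic `2`; NOT a
statement of the manuscript] **THE MULTIPLE-TANGENT CLASS HAS AT MOST TWO INFINITELY-NEAR DOUBLE POINTS**:
for an isolated double state of `z² = a(u₁,…,uₙ)` with `e(c) = 2` and `h₂(c) = 2` there is a set `S` of
AT MOST TWO vectors such that the near vector `(τ with τ_i = 1)` of every `(i, τ)` with a double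
successor is a multiple of a member of `S`: at most ONE satellite direction (successor corank `2`,
p536239) and at most ONE free direction (successor corank `0`, this file). Over a perfect field the
satellite exists (p538084): exactly one satellite and at most one free point — the binary cubic on the
kernel line is `ℓ₁²ℓ₂` (satellite `[ℓ₁ = 0]`, free point `[ℓ₂ = 0]`) or `ℓ₁³` (satellite only).
[folklore] -/
theorem hypersurface_nearPoints_le_two_of_milnorHilbertTwo_eq_two [CharP κ 2] (c : (Fin n → ℕ) → κ)
    (hM : MultP 2 n κ c) (he : milnorEmbDim 2 n κ c = 2) (hh : milnorHilbertTwo 2 n κ c = 2) :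
    ∃ S : Finset (Fin n → κ), S.card ≤ 2 ∧
      ∀ (i : Fin n) (τ : Fin n → κ), MultP 2 n κ (step 2 n κ i τ c) →
        ∃ w ∈ S, ∃ r : κ, Function.update τ i 1 = r • w := by
  -- one representative per corank class
  have hrep : ∀ k : ℕ, ∃ T : Finset (Fin n → κ), T.card ≤ 1 ∧
      ∀ (i : Fin n) (τ : Fin n → κ), MultP 2 n κ (step 2 n κ i τ c) →
        milnorEmbDim 2 n κ (step 2 n κ i τ c) = k → ∃ w ∈ T, ∃ r : κ, Function.update τ i 1 = r • w := by
    intro k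
    by_cases hex : ∃ (i : Fin n) (τ : Fin n → κ), MultP 2 n κ (step 2 n κ i τ c) ∧
        milnorEmbDim 2 n κ (step 2 n κ i τ c) = k
    · obtain ⟨i₀, τ₀, hM₀, he₀⟩ := hex
      refine ⟨{Function.update τ₀ i₀ 1}, by rw [Finset.card_singleton], fun i τ hM' he' =>
        ⟨_, Finset.mem_singleton_self _, ?_⟩⟩
      rcases hypersurface_milnorEmbDim_step_of_eq_two c i₀ τ₀ hM he hM₀ with h0 | h2
      · rw [h0] at he₀
        rw [← he₀] at he'
        exact hypersurface_free_successors_proportional c hM he (by omega) hM₀ hM' h0 he'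
      · rw [h2] at he₀
        rw [← he₀] at he'
        exact hypersurface_satellite_successors_proportional c hM he (by omega) hM₀ hM' h2 he'
    · exact ⟨∅, by rw [Finset.card_empty]; exact zero_le_one, fun i τ hM' he' =>
        absurd ⟨i, τ, hM', he'⟩ hex⟩
  obtain ⟨T₀, hT₀, hcov₀⟩ := hrep 0
  obtain ⟨T₂, hT₂, hcov₂⟩ := hrep 2
  refine ⟨T₀ ∪ T₂, (Finset.card_union_le _ _).trans (by omega), fun i τ hM' => ?_⟩
  rcases hypersurface_milnorEmbDim_step_of_eq_two c i τ hM he hM' with h0 | h2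
  · obtain ⟨w, hw, r, hr⟩ := hcov₀ i τ hM' h0
    exact ⟨w, Finset.mem_union_left _ hw, r, hr⟩
  · obtain ⟨w, hw, r, hr⟩ := hcov₂ i τ hM' h2
    exact ⟨w, Finset.mem_union_right _ hw, r, hr⟩

/-- [OURS · L1 W4.6 rung (ii) at `p = 2`, every dimension, PERFECT field; NOT a statement of the
manuscript] **THE CENSUS LINE `h₂ = 2` OVER A PERFECT FIELD**: an isolated double state with
`(e, h₂) = (2, 2)` has EXACTLY ONE satellite near point — a chart `(i, τ)` with a double successor of
corank `2`, isolated with smaller `μ` (p538084), all such having proportional near vectors — and every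
other double successor is free (corank `0`, isolated, `μ = 1`, nothing after), all free ones at a single
near point. The corank-two chain of infinitely-near double points is DETERMINISTIC here. [folklore] -/
theorem hypersurface_near_census_of_milnorHilbertTwo_eq_two [CharP κ 2] [PerfectField κ]
    (c : (Fin n → ℕ) → κ) (hM : MultP 2 n κ c) (hI : Isol 2 n κ c) (he : milnorEmbDim 2 n κ c = 2)
    (hh : milnorHilbertTwo 2 n κ c = 2) :
    (∃ (i : Fin n) (τ : Fin n → κ), MultP 2 n κ (step 2 n κ i τ c) ∧
        milnorEmbDim 2 n κ (step 2 n κ i τ c) = 2 ∧ Isol 2 n κ (step 2 n κ i τ c) ∧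
          mu 2 n κ (step 2 n κ i τ c) < mu 2 n κ c) ∧
      (∀ (i i' : Fin n) (τ τ' : Fin n → κ), MultP 2 n κ (step 2 n κ i τ c) →
        MultP 2 n κ (step 2 n κ i' τ' c) → milnorEmbDim 2 n κ (step 2 n κ i τ c) = 2 →
          milnorEmbDim 2 n κ (step 2 n κ i' τ' c) = 2 →
            ∃ r : κ, Function.update τ' i' 1 = r • Function.update τ i 1) ∧
      (∀ (i i' : Fin n) (τ τ' : Fin n → κ), MultP 2 n κ (step 2 n κ i τ c) →
        MultP 2 n κ (step 2 n κ i' τ' c) → milnorEmbDim 2 n κ (step 2 n κ i τ c) = 0 →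
          milnorEmbDim 2 n κ (step 2 n κ i' τ' c) = 0 →
            ∃ r : κ, Function.update τ' i' 1 = r • Function.update τ i 1) ∧
      ∀ (i : Fin n) (τ : Fin n → κ), MultP 2 n κ (step 2 n κ i τ c) →
        (milnorEmbDim 2 n κ (step 2 n κ i τ c) = 2 ∧ Isol 2 n κ (step 2 n κ i τ c) ∧
            mu 2 n κ (step 2 n κ i τ c) < mu 2 n κ c) ∨
          (milnorEmbDim 2 n κ (step 2 n κ i τ c) = 0 ∧ Isol 2 n κ (step 2 n κ i τ c) ∧
            mu 2 n κ (step 2 n κ i τ c) = 1 ∧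
              ∀ (i' : Fin n) (τ' : Fin n → κ), ¬ MultP 2 n κ (step 2 n κ i' τ' (step 2 n κ i τ c))) :=
  ⟨hypersurface_satellite_step_of_milnorHilbertTwo_eq_two c hM hI he hh,
    fun _ _ _ _ hM₁ hM₂ he₁ he₂ => hypersurface_satellite_successors_proportional c hM he (by omega) hM₁ hM₂ he₁ he₂,
    fun _ _ _ _ hM₁ hM₂ he₁ he₂ => hypersurface_free_successors_proportional c hM he (by omega) hM₁ hM₂ he₁ he₂,
    fun i τ hM' => hypersurface_successor_dichotomy_of_milnorHilbertTwo_le_two c hM hI he (by omega) i τ hM'⟩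

end CampaignW46.HypersurfacesCharTwo

end Summit.ResolutionOfSingularities.ResolutionOfSingularities.Theorems

end
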